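import Mathlib
import Summits.MatrixMultiplication.MatrixMultiplication.Theorems.FidelityWitnessesFidelityGapTwoSixExplicitGap

/-!
# `FidelityGapTwoSixExplicit` — slot and row vectors against the kernel; the captured mass `2/3`

Part of the proof of `FidelityWitnesses.FidelityGapTwoSixExplicit` (stmt-MatrixMultiplication-14041); see
`FidelityWitnessesFidelityGapTwoSixExplicitDefs.lean` for the line of argument.  Here: the pairings of
slot vectors `ℓ ⊗ e_a` and row vectors `rowVec b v` with arrays; on `kerSpan` a slot test only sees one
`U`-component of `ℓ` and reduces to a row test (`inner_slotVec_one`, `inner_slotVec_zero`); and the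
captured-mass identity `Σ_v ‖kerProj (rowVec b v)‖² = (2/3)‖b‖²` for traceless `b` (integer matrix
identity in the `8` coordinates of `b`, decided by the kernel).
-/

noncomputable section

namespace Summit.MatrixMultiplication.MatrixMultiplication.Theorems.GapTwoSixExplicit

-- single-conjunct summit: the `Summit.<S>.<P>` prefix repeats `MatrixMultiplication` by design (D-0017)
set_option linter.dupNamespace false

open scoped BigOperators ComplexConjugate InnerProductSpace
open Literature.Computability.AlgebraicComplexity

/-! ## Slot vectors and row vectors against the kernel -/

/-- `⟪ℓ ⊗ e_a, y⟫ = Σ_p conj (ℓ p) · y (p, a)`. [folklore] -/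
theorem inner_slotVec (ℓ : V16) (a : P2) (y : V64) :
    ⟪slotVec ℓ a, y⟫_ℂ = ∑ p : P2 × P2, conj (ℓ p) * y (p, a) := by
  rw [inner_V64, Fintype.sum_prod_type]
  refine Finset.sum_congr rfl fun p _ => ?_
  rw [Finset.sum_eq_single a]
  · simp [slotVec]
  · intro a' _ ha'
    simp [slotVec, ha']
  · intro h; exact absurd (Finset.mem_univ _) h

/-- `⟪rowVec b v, y⟫ = Σ_{j,m} conj (b (j,m)) · y (((0,j),m),(1,v))`. [folklore] -/
theorem inner_rowVec (b : V8) (v : Fin 2) (y : V64) :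
    ⟪rowVec b v, y⟫_ℂ = ∑ j : Fin 2, ∑ m : P2, conj (b (j, m)) * y (((0, j), m), (1, v)) := by
  rw [inner_V64, Fintype.sum_prod_type]
  -- sum over `p = ((i, j), m)` then over `a`
  rw [Fintype.sum_prod_type, Fintype.sum_prod_type, Fin.sum_univ_two]
  have h1 : ∀ (j : Fin 2) (m : P2), (∑ a : P2, conj (rowVec b v (((1, j), m), a)) * y (((1, j), m), a))
      = 0 := by
    intro j m
    refine Finset.sum_eq_zero fun a _ => ?_
    simp [rowVec]
  have h0 : ∀ (j : Fin 2) (m : P2), (∑ a : P2, conj (rowVec b v (((0, j), m), a)) * y (((0, j), m), a))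
      = conj (b (j, m)) * y (((0, j), m), (1, v)) := by
    intro j m
    rw [Finset.sum_eq_single ((1 : Fin 2), v)]
    · simp [rowVec]
    · intro a _ ha
      simp [rowVec, ha]
    · intro h; exact absurd (Finset.mem_univ _) h
  simp only [h1, h0, Finset.sum_const_zero, add_zero]

/-- Testing a kernel element against `ℓ ⊗ e_{(1,v)}` only sees the `U`-component `hComp 0 ℓ`:
`⟪ℓ ⊗ e_{(1,v)}, y⟫ = ⟪rowVec (hComp 0 ℓ) v, y⟫` for `y ∈ kerSpan`. [folklore] -/
theorem inner_slotVec_one {y : V64} (hy : y ∈ kerSpan) (ℓ : V16) (v : Fin 2) :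
    ⟪slotVec ℓ (1, v), y⟫_ℂ = ⟪rowVec (hComp 0 ℓ) v, y⟫_ℂ := by
  rw [inner_slotVec, inner_rowVec, Fintype.sum_prod_type, Fintype.sum_prod_type, Fin.sum_univ_two]
  have h1 : ∀ (j : Fin 2) (m : P2), conj (ℓ ((1, j), m)) * y (((1, j), m), (1, v)) = 0 := by
    intro j m
    rw [kerSpan_diagU hy (((1, j), m), (1, v)) rfl, mul_zero]
  simp only [h1, Finset.sum_const_zero, add_zero]
  rfl

/-- Testing a kernel element against `ℓ ⊗ e_{(0,v)}` only sees `hComp 1 ℓ`, with a sign: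
`⟪ℓ ⊗ e_{(0,v)}, y⟫ = -⟪rowVec (hComp 1 ℓ) v, y⟫` for `y ∈ kerSpan`. [folklore] -/
theorem inner_slotVec_zero {y : V64} (hy : y ∈ kerSpan) (ℓ : V16) (v : Fin 2) :
    ⟪slotVec ℓ (0, v), y⟫_ℂ = -⟪rowVec (hComp 1 ℓ) v, y⟫_ℂ := by
  rw [inner_slotVec, inner_rowVec, Fintype.sum_prod_type, Fintype.sum_prod_type, Fin.sum_univ_two]
  have h0 : ∀ (j : Fin 2) (m : P2), conj (ℓ ((0, j), m)) * y (((0, j), m), (0, v)) = 0 := by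
    intro j m
    rw [kerSpan_diagU hy (((0, j), m), (0, v)) rfl, mul_zero]
  have h1 : ∀ (j : Fin 2) (m : P2),
      conj (ℓ ((1, j), m)) * y (((1, j), m), (0, v))
        = -(conj (hComp 1 ℓ (j, m)) * y (((0, j), m), (1, v))) := by
    intro j m
    have ha := kerSpan_antisym hy (((0, v), m), (1, j))
    simp only at ha
    rw [ha, kerSpan_symJV hy j v m]
    simp [hComp]
  simp only [h0, h1, Finset.sum_const_zero, zero_add, Finset.sum_neg_distrib]

/-! ## The captured mass of the rows: `Σ_v ‖kerProj (rowVec b v)‖² = (2/3)‖b‖²` on `sl(V) ⊗ W*` -/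

/-- Inner products of kernel vectors with row vectors as integer linear forms in the `8`
coordinates of `b`. [folklore] -/
theorem inner_kerVec_rowVec (ws : Fin 2 × Fin 4) (b : V8) (v : Fin 2) :
    ⟪kerVec ws, rowVec b v⟫_ℂ
      = ∑ q : Fin 2 × P2, ((kerTab ws (((0, q.1), q.2), (1, v)) : ℤ) : ℂ) * b q := by
  rw [← inner_conj_symm, inner_rowVec, map_sum, Fintype.sum_prod_type]
  refine Finset.sum_congr rfl fun j _ => ?_
  rw [map_sum]
  refine Finset.sum_congr rfl fun m _ => ?_
  simp [kerVec_apply, mul_comm]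

/-- Norms on `V8` in coordinates. [folklore] -/
theorem norm_sq_V8 (x : V8) : ‖x‖ ^ 2 = ∑ q, ‖x q‖ ^ 2 := EuclideanSpace.norm_sq_eq x

/-- **Captured mass of the rows.** For traceless `b` (i.e. `b ∈ sl(V) ⊗ W*`):
`Σ_v ‖kerProj (rowVec b v)‖² = (2/3) ‖b‖²` (the multiplication map `S²V ⊗ V → S³V` is, up to the
factor `√(2/3)·‖·‖`, a co-isometry on each `b ⊗ V`).  Integer identity in the `8` coordinates of
`b`, decided by the kernel after the integer de-tracing `b ↦ 2b − tr`. [folklore] -/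
theorem sum_norm_sq_kerProj_rowVec {b : V8} (hb : b ∈ traceless) :
    (∑ v : Fin 2, ‖kerProj (rowVec b v)‖ ^ 2) = 2 / 3 * ‖b‖ ^ 2 := by
  -- integer de-tracing matrix `D` (for traceless `b`, `D b = 2 b`)
  let D : Fin 2 × P2 → Fin 2 × P2 → ℤ := fun q q' =>
    (if q' = q then 2 else 0) - (if q.1 = q.2.1 ∧ q'.1 = q'.2.1 ∧ q'.2.2 = q.2.2 then 1 else 0)
  have hDb : ∀ q : Fin 2 × P2, (∑ q', ((D q q' : ℤ) : ℂ) * b q') = 2 * b q := by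
    intro q
    obtain ⟨j, m1, w⟩ := q
    have h0 := hb 0
    have h1 := hb 1
    fin_cases j <;> fin_cases m1 <;> fin_cases w <;>
      simp [D, Fintype.sum_prod_type, Fin.sum_univ_two] <;>
      first
        | linear_combination (-1 : ℂ) * h0
        | linear_combination (-1 : ℂ) * h1
  -- the kernel-row coefficient vectors composed with `D`
  let c : (Fin 2 × Fin 4) × Fin 2 → Fin 2 × P2 → ℤ := fun t q' =>
    ∑ q : Fin 2 × P2, kerTab t.1 (((0, q.1), q.2), (1, t.2)) * D q q'
  have key : ∀ p q : Fin 2 × P2,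
      (∑ t : (Fin 2 × Fin 4) × Fin 2, ((6 / kerNsq t.1 : ℕ) : ℤ) * (c t p * c t q))
        = ∑ t : Fin 2 × P2, 4 * (D t p * D t q) := by
    decide +kernel
  -- the two sides as Hermitian double sums in `b`
  have hK : ∀ t : (Fin 2 × Fin 4) × Fin 2,
      2 * ⟪kerVec t.1, rowVec b t.2⟫_ℂ = ∑ q', ((c t q' : ℤ) : ℂ) * b q' := by
    intro t
    rw [inner_kerVec_rowVec, Finset.mul_sum]
    have h1 : ∀ q : Fin 2 × P2, (2 : ℂ) * (((kerTab t.1 (((0, q.1), q.2), (1, t.2)) : ℤ) : ℂ) * b q)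
        = ∑ q', ((kerTab t.1 (((0, q.1), q.2), (1, t.2)) : ℤ) : ℂ) * (((D q q' : ℤ) : ℂ) * b q') := by
      intro q
      rw [← Finset.mul_sum, hDb q]
      ring
    simp_rw [h1]
    rw [Finset.sum_comm]
    refine Finset.sum_congr rfl fun q' _ => ?_
    simp only [c]
    push_cast
    rw [Finset.sum_mul]
    refine Finset.sum_congr rfl fun q _ => ?_
    ring
  have hC : (∑ t : (Fin 2 × Fin 4) × Fin 2, (((6 / kerNsq t.1 : ℕ) : ℤ) : ℂ)
        * (conj (∑ q', ((c t q' : ℤ) : ℂ) * b q') * (∑ q', ((c t q' : ℤ) : ℂ) * b q')))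
      = ∑ t : Fin 2 × P2, ((4 : ℤ) : ℂ)
        * (conj (∑ q', ((D t q' : ℤ) : ℂ) * b q') * (∑ q', ((D t q' : ℤ) : ℂ) * b q')) := by
    rw [sum_weight_conj_linform_mul_linform, sum_weight_conj_linform_mul_linform]
    refine Finset.sum_congr rfl fun p _ => Finset.sum_congr rfl fun q _ => ?_
    rw [key p q]
  -- rewrite in terms of `⟪kerVec, rowVec⟫` and `b`
  have hC' : (∑ t : (Fin 2 × Fin 4) × Fin 2, (((6 / kerNsq t.1 : ℕ) : ℤ) : ℂ)
        * (conj (2 * ⟪kerVec t.1, rowVec b t.2⟫_ℂ) * (2 * ⟪kerVec t.1, rowVec b t.2⟫_ℂ)))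
      = ∑ t : Fin 2 × P2, ((4 : ℤ) : ℂ) * (conj (2 * b t) * (2 * b t)) := by
    simp_rw [← hK, hDb] at hC
    exact hC
  have hreal : (∑ t : (Fin 2 × Fin 4) × Fin 2, ((6 / kerNsq t.1 : ℕ) : ℝ)
        * ‖2 * ⟪kerVec t.1, rowVec b t.2⟫_ℂ‖ ^ 2)
      = ∑ t : Fin 2 × P2, (4 : ℝ) * ‖2 * b t‖ ^ 2 := by
    have h := hC'
    simp only [Complex.conj_mul'] at h
    exact_mod_cast h
  -- conclude
  have hwt : ∀ ws : Fin 2 × Fin 4, ((6 / kerNsq ws : ℕ) : ℝ) * (kerNsq ws : ℝ) = 6 := by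
    intro ws
    unfold kerNsq
    split_ifs <;> norm_num
  have hL : (∑ t : (Fin 2 × Fin 4) × Fin 2, ((6 / kerNsq t.1 : ℕ) : ℝ)
        * ‖2 * ⟪kerVec t.1, rowVec b t.2⟫_ℂ‖ ^ 2)
      = 24 * ∑ v : Fin 2, ‖kerProj (rowVec b v)‖ ^ 2 := by
    simp_rw [norm_sq_kerProj]
    rw [Finset.mul_sum, Fintype.sum_prod_type_right]
    refine Finset.sum_congr rfl fun v _ => ?_
    rw [Finset.mul_sum]
    refine Finset.sum_congr rfl fun ws _ => ?_
    have hpos : (0 : ℝ) < kerNsq ws := by exact_mod_cast kerNsq_pos ws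
    have h := hwt ws
    rw [norm_mul, mul_pow]
    field_simp
    norm_num
    nlinarith [h]
  have hR : (∑ t : Fin 2 × P2, (4 : ℝ) * ‖2 * b t‖ ^ 2) = 16 * ‖b‖ ^ 2 := by
    rw [norm_sq_V8, Finset.mul_sum]
    refine Finset.sum_congr rfl fun t _ => ?_
    rw [norm_mul, mul_pow]
    norm_num
    ring
  rw [hL, hR] at hreal
  linarith

end Summit.MatrixMultiplication.MatrixMultiplication.Theorems.GapTwoSixExplicit

end
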